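import Mathlib
import Summits.ValiantsHypothesis.ValiantsHypothesis.Theorems.BarrierLeverPartitionMinorsHitByVPAdditiveObstruction

/-!
# Route BarrierLever — item `PartitionMinorsHitByVP` (stmt-ValiantsHypothesis-19717):
# DOUBLY Hilbert-obstructed layouts — the additive dichotomy (door of record v5) is FALSE

Helper / negative file (`--supports stmt-ValiantsHypothesis-19717`; cell valiant-natproofs, rung V4,
𝒟-side, prover seat val-np-p6 gen 4). Definition-free. Closes NO item; it REFUTES the hypothesis of the
link file `…AdditiveDichotomy.partitionMinorsHitByVP_of_additiveDichotomy` (p512016, val-np-p6 gen 3),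
i.e. the conjecture «SH: no injective layout is Hilbert-obstructed in both orientations», which had been
checked for every layout at `h = 4` and for `r ≤ 5` at `h = 5`.

Notation: rows `u i`, columns `w j ⊆ Fin h`; the additive matrix of a table `(ω₀, ω)` is
`A[i,j] = ∏_{c ∈ w j} (ω₀ c + Σ_{a ∈ u i} ω a c)`, its mirror is the additive matrix of `(w, u)`.
`…AdditiveObstruction.additiveMatrix_det_eq_zero_of_hilbert` (p510322): if more than
`H_u(d) = rank [[R ⊆ u i]]_{i, |R| ≤ d}` columns have `|w j ∖ C₀| ≤ d`, then `det A = 0` for EVERY table.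
This file adds two COMBINATORIAL corollaries (rank bounds one can check by counting) and combines them.

* `rank_indicatorsOne_le` — `H_u(1) ≤ 1 + |⋃_i u i|` (the columns `R = {a}`, `a ∉ ⋃ u`, vanish); hence
  **`additiveMatrix_det_eq_zero_of_weightOne`** (L1, SUPPORT BOUND): more than `1 + |⋃ u|` columns of
  weight `≤ 1` above a common core ⇒ `det A = 0` for every table.
* `sum_powerset_neg_one_pow_indicator_eq_zero` — `Σ_{S ⊆ T} (−1)^{|S|} [R ⊆ Z ∪ S] = 0` when `|R| < |T|`;
  hence `rank_indicators_lt_card_of_subcube` — if the rows contain a SUBCUBE `{Z ∪ S : S ⊆ T}` with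
  `|T| > e`, `Z ∩ T = ∅`, then `H_u(e) < #rows` (the alternating vector on the subcube is a dependency
  among the rows of `[[R ⊆ u i]]_{|R| ≤ e}`); hence **`additiveMatrix_det_eq_zero_of_subcube`** (L2,
  SUBCUBE SYZYGY): if EVERY column has weight `≤ e` above a common core and the rows contain an
  `(e+1)`-subcube, `det A = 0` for every table.
* **`additive_cex_direct_det_eq_zero`, `additive_cex_mirror_det_eq_zero`, `not_additiveDichotomy`** —
  the layout `h = 5`, `r = 10`, rows `u = K₄ = {0},{1},{2},{3},{01},{02},{03},{12},{13},{23}`, columns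
  `w = ∅,{0},{1},{2},{3},{4},{01},{02},{12},{012}`: the direct matrix is singular for every table by L1
  (six columns of weight `≤ 1`, `1 + |⋃ u| = 5`), the mirror by L2 (all `|u j| ≤ 2`, the columns contain
  the 3-subcube `2^{012}`); so the hypothesis of `partitionMinorsHitByVP_of_additiveDichotomy` — quoted
  VERBATIM as the negated statement — fails. (This particular layout has `r = 10 ≤ (2h)⁴` and is hit by
  a sparse witness; the point is the door, not the item.)
* **`additive_doublyObstructed`** — the mechanism at every scale: rows of size `≤ e` with
  `1 + |⋃ u| <` (number of columns of weight `≤ 1`), columns containing an `(e+1)`-subcube ⇒ BOTH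
  orientations singular for every table. Instance (docstring): rows = all subsets of size `≤ e` of `h − 2`
  coordinates, columns ⊇ `{∅} ∪ singletons ∪ 2^T` (`|T| = e+1`): `r = C(h−2, ≤ e)`, exponential in `h`;
  with columns `B([h], e′) ∪ (Z ⊔ 2^T)` both obstructions survive the removal of poly(h) rows/columns.

Consequences for the programme (memo RESIDUE-v6-p6g4.md on item 19717): door of record v5 is dead as a
∀-layout statement; the additive table and its mirror remain LEAVES (exact reach conjecturally = the
Hilbert condition, H1), to be combined by the cell door `…CellDoor.partitionMinor_hit_of_cells`.

WHAT THIS IS NOT: no statement about item 19717 itself (every layout exhibited here is hit by other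
witnesses); nothing on crux 14610 or VP vs VNP.
-/

set_option linter.dupNamespace false

namespace Summit.ValiantsHypothesis.ValiantsHypothesis.Theorems.BarrierLever.AdditiveDoor

open Finset

noncomputable section

variable {h : ℕ}

/-! ## 1. Level one: the support bound (L1) -/

/-- `H_u(1) ≤ 1 + |⋃_i u i|`: the indicator matrix `[[R ⊆ u i]]_{i, |R| ≤ 1}` has rank at most one plus
the number of coordinates used by the rows (the column of `{a}` vanishes when `a ∉ ⋃ u`). -/
theorem rank_indicatorsOne_le {ι : Type*} [Fintype ι] [DecidableEq ι] (u : ι → Finset (Fin h)) :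
    (Matrix.of fun (i : ι) (R : {R : Finset (Fin h) // R.card ≤ 1}) =>
        if R.1 ⊆ u i then (1 : ℂ) else 0).rank ≤ 1 + (Finset.univ.biUnion u).card := by
  classical
  set E : Matrix ι {R : Finset (Fin h) // R.card ≤ 1} ℂ :=
    Matrix.of fun i R => if R.1 ⊆ u i then (1 : ℂ) else 0 with hE
  set U : Finset (Fin h) := Finset.univ.biUnion u with hU
  have h0 : (∅ : Finset (Fin h)).card ≤ 1 := by simp
  have h1 : ∀ a : Fin h, ({a} : Finset (Fin h)).card ≤ 1 := fun a => by simp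
  -- candidate spanning set: the column of `∅` and the columns of `{a}`, `a ∈ U`
  set S : Finset (ι → ℂ) := insert (E.col ⟨∅, h0⟩) (U.image fun a => E.col ⟨{a}, h1 a⟩) with hS
  have hcolmem : ∀ R : {R : Finset (Fin h) // R.card ≤ 1},
      E.col R ∈ Submodule.span ℂ (S : Set (ι → ℂ)) := by
    intro R
    rcases Nat.le_one_iff_eq_zero_or_eq_one.mp R.2 with hR0 | hR1
    · have hR : R.1 = ∅ := Finset.card_eq_zero.mp hR0
      have hcol : E.col R = E.col ⟨∅, h0⟩ := by
        funext i
        simp [Matrix.col_apply, hE, hR]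
      rw [hcol]
      exact Submodule.subset_span (by simp [hS])
    · obtain ⟨a, ha⟩ := Finset.card_eq_one.mp hR1
      by_cases haU : a ∈ U
      · have hcol : E.col R = E.col ⟨{a}, h1 a⟩ := by
          funext i
          simp [Matrix.col_apply, hE, ha]
        rw [hcol]
        refine Submodule.subset_span ?_
        rw [hS, Finset.coe_insert, Finset.coe_image]
        exact Set.mem_insert_of_mem _ ⟨a, by simpa using haU, rfl⟩
      · have hcol : E.col R = 0 := by
          funext i
          have hai : a ∉ u i := fun hai =>
            haU (by rw [hU]; exact Finset.mem_biUnion.mpr ⟨i, Finset.mem_univ i, hai⟩)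
          have hnot : ¬ R.1 ⊆ u i := by
            rw [ha]
            exact fun hsub => hai (hsub (Finset.mem_singleton_self a))
          simp [Matrix.col_apply, hE, hnot]
        rw [hcol]
        exact Submodule.zero_mem _
  have hspan : Submodule.span ℂ (Set.range E.col) ≤ Submodule.span ℂ (S : Set (ι → ℂ)) :=
    Submodule.span_le.mpr (by rintro _ ⟨R, rfl⟩; exact hcolmem R)
  have hfin : Module.finrank ℂ (Submodule.span ℂ (S : Set (ι → ℂ))) ≤ S.card := by
    simpa using finrank_span_le_card (R := ℂ) (S : Set (ι → ℂ))
  calc E.rank = Module.finrank ℂ (Submodule.span ℂ (Set.range E.col)) :=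
        Matrix.rank_eq_finrank_span_cols E
    _ ≤ Module.finrank ℂ (Submodule.span ℂ (S : Set (ι → ℂ))) := Submodule.finrank_mono hspan
    _ ≤ S.card := hfin
    _ ≤ (U.image fun a => E.col ⟨{a}, h1 a⟩).card + 1 := Finset.card_insert_le _ _
    _ ≤ U.card + 1 := Nat.add_le_add_right Finset.card_image_le 1
    _ = 1 + U.card := Nat.add_comm _ _

/-- **L1 (support bound).** If more than `1 + |⋃_i u i|` columns have weight `≤ 1` above a common core
`C₀ ⊆ w j`, the additive matrix is singular for EVERY table. -/
theorem additiveMatrix_det_eq_zero_of_weightOne {ι : Type*} [Fintype ι] [DecidableEq ι]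
    (u w : ι → Finset (Fin h)) (ω₀ : Fin h → ℂ) (ω : Fin h → Fin h → ℂ) (C₀ : Finset (Fin h))
    (hC : ∀ j, C₀ ⊆ w j)
    (hcount : 1 + (Finset.univ.biUnion u).card <
      (Finset.univ.filter fun j => (w j \ C₀).card ≤ 1).card) :
    (Matrix.of fun i j : ι => ∏ c ∈ w j, (ω₀ c + ∑ a ∈ u i, ω a c)).det = 0 :=
  additiveMatrix_det_eq_zero_of_hilbert u w ω₀ ω C₀ hC 1
    (lt_of_le_of_lt (rank_indicatorsOne_le u) hcount)

/-! ## 2. The subcube syzygy (L2) -/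

/-- Alternating sums over a cube kill the inclusion indicators of small sets:
`Σ_{S ⊆ T} (−1)^{|S|} [R ⊆ Z ∪ S] = 0` whenever `|R| < |T|`. -/
theorem sum_powerset_neg_one_pow_indicator_eq_zero (Z T R : Finset (Fin h))
    (hRT : R.card < T.card) :
    ∑ S ∈ T.powerset, (-1 : ℂ) ^ S.card * (if R ⊆ Z ∪ S then (1 : ℂ) else 0) = 0 := by
  classical
  set R' : Finset (Fin h) := R \ Z with hR'
  have hiff : ∀ S : Finset (Fin h), (R ⊆ Z ∪ S ↔ R' ⊆ S) := fun S => by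
    rw [hR']
    constructor
    · intro hsub x hx
      rw [Finset.mem_sdiff] at hx
      rcases Finset.mem_union.mp (hsub hx.1) with hz | hs
      · exact absurd hz hx.2
      · exact hs
    · intro hsub x hx
      by_cases hz : x ∈ Z
      · exact Finset.mem_union_left _ hz
      · exact Finset.mem_union_right _ (hsub (Finset.mem_sdiff.mpr ⟨hx, hz⟩))
  simp_rw [hiff, mul_ite, mul_one, mul_zero]
  rw [← Finset.sum_filter]
  by_cases hRT' : R' ⊆ T
  · -- the superset interval `[R', T]` is a translated cube of positive dimension
    have hIcc : T.powerset.filter (fun S => R' ⊆ S) = Finset.Icc R' T := by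
      rw [Finset.Icc_eq_filter_powerset]
    rw [hIcc, Finset.Icc_eq_image_powerset hRT', Finset.sum_image]
    · have hdisj : ∀ S ∈ (T \ R').powerset, Disjoint R' S := fun S hS =>
        Finset.disjoint_of_subset_right (Finset.mem_powerset.mp hS) Finset.disjoint_sdiff
      have hsum : ∑ S ∈ (T \ R').powerset, (-1 : ℂ) ^ (R' ∪ S).card =
          (-1 : ℂ) ^ R'.card * ∑ S ∈ (T \ R').powerset, (-1 : ℂ) ^ S.card := by
        rw [Finset.mul_sum]
        refine Finset.sum_congr rfl fun S hS => ?_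
        rw [Finset.card_union_of_disjoint (hdisj S hS), pow_add]
      have hne : (T \ R').Nonempty := by
        rw [Finset.nonempty_iff_ne_empty, Ne, Finset.sdiff_eq_empty_iff_subset]
        intro hTR
        have h1 : T.card ≤ R'.card := Finset.card_le_card hTR
        have h2 : R'.card ≤ R.card := Finset.card_le_card Finset.sdiff_subset
        omega
      have hzero : ∑ S ∈ (T \ R').powerset, (-1 : ℂ) ^ S.card = 0 := by
        have hz := congrArg (Int.cast : ℤ → ℂ) (Finset.sum_powerset_neg_one_pow_card_of_nonempty hne)
        push_cast at hz
        exact hz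
      rw [hsum, hzero, mul_zero]
    · intro S₁ hS₁ S₂ hS₂ heq
      have hd₁ : Disjoint R' S₁ :=
        Finset.disjoint_of_subset_right (Finset.mem_powerset.mp (Finset.mem_coe.mp hS₁))
          Finset.disjoint_sdiff
      have hd₂ : Disjoint R' S₂ :=
        Finset.disjoint_of_subset_right (Finset.mem_powerset.mp (Finset.mem_coe.mp hS₂))
          Finset.disjoint_sdiff
      have := congrArg (fun X : Finset (Fin h) => X \ R') heq
      simpa [Finset.union_sdiff_cancel_left hd₁, Finset.union_sdiff_cancel_left hd₂] using this
  · refine Finset.sum_eq_zero fun S hS => ?_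
    exfalso
    rw [Finset.mem_filter, Finset.mem_powerset] at hS
    exact hRT' (hS.2.trans hS.1)

/-- If the rows contain a subcube `{Z ∪ S : S ⊆ T}` (`Z ∩ T = ∅`, enumerated by `φ`) of dimension
`|T| > e`, the indicator matrix `[[R ⊆ u i]]_{i, |R| ≤ e}` has rank `< #rows`: the alternating vector
on the subcube rows is a linear dependency among its rows. -/
theorem rank_indicators_lt_card_of_subcube {ι : Type*} [Fintype ι] [DecidableEq ι]
    (u : ι → Finset (Fin h)) (e : ℕ) (Z T : Finset (Fin h)) (hZT : Disjoint Z T) (hT : e < T.card)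
    (φ : Finset (Fin h) → ι) (hφ : ∀ S ∈ T.powerset, u (φ S) = Z ∪ S) :
    (Matrix.of fun (i : ι) (R : {R : Finset (Fin h) // R.card ≤ e}) =>
        if R.1 ⊆ u i then (1 : ℂ) else 0).rank < Fintype.card ι := by
  classical
  set E : Matrix ι {R : Finset (Fin h) // R.card ≤ e} ℂ :=
    Matrix.of fun i R => if R.1 ⊆ u i then (1 : ℂ) else 0 with hE
  -- the alternating vector on the subcube rows
  set lam : ι → ℂ := fun i => ∑ S ∈ T.powerset, if φ S = i then (-1 : ℂ) ^ S.card else 0 with hlam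
  have hdep : ∑ i, lam i • E.row i = 0 := by
    funext R
    simp only [Finset.sum_apply, Pi.smul_apply, smul_eq_mul, Pi.zero_apply]
    have hrow : ∀ i, E.row i R = if R.1 ⊆ u i then (1 : ℂ) else 0 := fun i => rfl
    simp_rw [hrow, hlam, Finset.sum_mul]
    rw [Finset.sum_comm]
    have hinner : ∀ S ∈ T.powerset, ∑ i : ι, (if φ S = i then (-1 : ℂ) ^ S.card else 0) *
        (if R.1 ⊆ u i then (1 : ℂ) else 0) =
        (-1 : ℂ) ^ S.card * (if R.1 ⊆ Z ∪ S then (1 : ℂ) else 0) := by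
      intro S hS
      simp_rw [ite_mul, zero_mul]
      rw [Finset.sum_ite_eq Finset.univ (φ S), if_pos (Finset.mem_univ _), hφ S hS]
    rw [Finset.sum_congr rfl hinner]
    exact sum_powerset_neg_one_pow_indicator_eq_zero Z T R.1 (lt_of_le_of_lt R.2 hT)
  have hne : lam (φ ∅) ≠ 0 := by
    have hval : lam (φ ∅) = 1 := by
      rw [hlam]
      simp only
      rw [Finset.sum_eq_single_of_mem ∅ (Finset.empty_mem_powerset T)]
      · simp
      · intro S hS hSne
        rw [if_neg]
        intro heq
        apply hSne
        have h1 := hφ S hS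
        have h2 := hφ ∅ (Finset.empty_mem_powerset T)
        rw [heq, h2, Finset.union_empty] at h1
        -- `Z = Z ∪ S` with `S ⊆ T`, `Z ∩ T = ∅` forces `S = ∅`
        have hSZ : S ⊆ Z := fun x hx => by
          have : x ∈ Z ∪ S := Finset.mem_union_right _ hx
          rwa [← h1] at this
        have hST : S ⊆ T := Finset.mem_powerset.mp hS
        exact Finset.eq_empty_of_forall_notMem fun x hx =>
          Finset.disjoint_left.mp hZT (hSZ hx) (hST hx)
    rw [hval]
    exact one_ne_zero
  have hnotLI : ¬ LinearIndependent ℂ E.row := by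
    intro hLI
    exact hne ((Fintype.linearIndependent_iff.mp hLI) lam hdep (φ ∅))
  have hle : (Set.range E.row).finrank ℂ ≤ Fintype.card ι := finrank_range_le_card (R := ℂ) E.row
  have hne' : (Set.range E.row).finrank ℂ ≠ Fintype.card ι := fun heq =>
    hnotLI (linearIndependent_iff_card_eq_finrank_span.mpr heq.symm)
  rw [Matrix.rank_eq_finrank_span_row]
  exact lt_of_le_of_ne hle hne'

/-- **L2 (subcube syzygy).** If EVERY column has weight `≤ e` above a common core `C₀ ⊆ w j` and the
rows contain a subcube `{Z ∪ S : S ⊆ T}` with `|T| > e`, `Z ∩ T = ∅`, the additive matrix is singular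
for EVERY table. -/
theorem additiveMatrix_det_eq_zero_of_subcube {ι : Type*} [Fintype ι] [DecidableEq ι]
    (u w : ι → Finset (Fin h)) (ω₀ : Fin h → ℂ) (ω : Fin h → Fin h → ℂ) (C₀ : Finset (Fin h))
    (hC : ∀ j, C₀ ⊆ w j) (e : ℕ) (hdeg : ∀ j, (w j \ C₀).card ≤ e)
    (Z T : Finset (Fin h)) (hZT : Disjoint Z T) (hT : e < T.card)
    (φ : Finset (Fin h) → ι) (hφ : ∀ S ∈ T.powerset, u (φ S) = Z ∪ S) :
    (Matrix.of fun i j : ι => ∏ c ∈ w j, (ω₀ c + ∑ a ∈ u i, ω a c)).det = 0 := by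
  classical
  refine additiveMatrix_det_eq_zero_of_hilbert u w ω₀ ω C₀ hC e ?_
  have hall : (Finset.univ.filter fun j => (w j \ C₀).card ≤ e) = Finset.univ :=
    Finset.filter_true_of_mem fun j _ => hdeg j
  rw [hall, Finset.card_univ]
  exact rank_indicators_lt_card_of_subcube u e Z T hZT hT φ hφ

/-! ## 3. The counterexample to the additive dichotomy (`h = 5`, `r = 10`) -/

/-- Direct orientation of the layout `u = K₄`, `w = ∅,{0},{1},{2},{3},{4},{01},{02},{12},{012}` at
`h = 5`: six columns of weight `≤ 1` but `1 + |⋃ u| = 5`, so the additive matrix is singular for every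
table (L1). -/
theorem additive_cex_direct_det_eq_zero (ω₀ : Fin 5 → ℂ) (ω : Fin 5 → Fin 5 → ℂ) :
    (Matrix.of fun i j : Fin 10 =>
      ∏ c ∈ (![∅, {0}, {1}, {2}, {3}, {4}, {0, 1}, {0, 2}, {1, 2}, {0, 1, 2}] :
          Fin 10 → Finset (Fin 5)) j,
        (ω₀ c + ∑ a ∈ (![{0}, {1}, {2}, {3}, {0, 1}, {0, 2}, {0, 3}, {1, 2}, {1, 3}, {2, 3}] :
          Fin 10 → Finset (Fin 5)) i, ω a c)).det = 0 :=
  additiveMatrix_det_eq_zero_of_weightOne _ _ ω₀ ω ∅ (fun _ => Finset.empty_subset _) (by decide)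

/-- Mirror orientation of the same layout (rows `w`, columns `u`): every `|u j| ≤ 2` while the rows
contain the 3-subcube `2^{012}`, so the mirror additive matrix is singular for every table (L2). -/
theorem additive_cex_mirror_det_eq_zero (ω₀ : Fin 5 → ℂ) (ω : Fin 5 → Fin 5 → ℂ) :
    (Matrix.of fun i j : Fin 10 =>
      ∏ a ∈ (![{0}, {1}, {2}, {3}, {0, 1}, {0, 2}, {0, 3}, {1, 2}, {1, 3}, {2, 3}] :
          Fin 10 → Finset (Fin 5)) j,
        (ω₀ a + ∑ c ∈ (![∅, {0}, {1}, {2}, {3}, {4}, {0, 1}, {0, 2}, {1, 2}, {0, 1, 2}] :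
          Fin 10 → Finset (Fin 5)) i, ω c a)).det = 0 :=
  additiveMatrix_det_eq_zero_of_subcube _ _ ω₀ ω ∅ (fun _ => Finset.empty_subset _) 2 (by decide)
    ∅ {0, 1, 2} (Finset.disjoint_empty_left _) (by decide)
    (fun S => if S = ∅ then 0 else if S = {0} then 1 else if S = {1} then 2 else if S = {2} then 3
      else if S = {0, 1} then 6 else if S = {0, 2} then 7 else if S = {1, 2} then 8 else 9)
    (by decide)

/-- **The additive dichotomy is false.** The hypothesis of
`…AdditiveDichotomy.partitionMinorsHitByVP_of_additiveDichotomy` (p512016) — «for every `h ≥ 2` and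
every injective layout some additive table is nonsingular on `(u, w)` or on `(w, u)`» — fails: at
`h = 5`, `r = 10` the layout `u = K₄`, `w = ∅,{0},{1},{2},{3},{4},{01},{02},{12},{012}` is Hilbert-
obstructed in BOTH orientations (`additive_cex_direct_det_eq_zero`, `additive_cex_mirror_det_eq_zero`).
The negated statement is quoted verbatim from p512016. -/
theorem not_additiveDichotomy :
    ¬ (∀ h : ℕ, 2 ≤ h → ∀ (r : ℕ) (u w : Fin r → Finset (Fin h)),
      Function.Injective u → Function.Injective w →
      (∃ (ω₀ : Fin h → ℂ) (ω : Fin h → Fin h → ℂ),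
        (Matrix.of fun i j : Fin r => ∏ c ∈ w j, (ω₀ c + ∑ a ∈ u i, ω a c)).det ≠ 0) ∨
      (∃ (ω₀ : Fin h → ℂ) (ω : Fin h → Fin h → ℂ),
        (Matrix.of fun i j : Fin r => ∏ a ∈ u j, (ω₀ a + ∑ c ∈ w i, ω c a)).det ≠ 0)) := by
  intro hyp
  rcases hyp 5 (by norm_num) 10
      (![{0}, {1}, {2}, {3}, {0, 1}, {0, 2}, {0, 3}, {1, 2}, {1, 3}, {2, 3}] : Fin 10 → Finset (Fin 5))
      (![∅, {0}, {1}, {2}, {3}, {4}, {0, 1}, {0, 2}, {1, 2}, {0, 1, 2}] : Fin 10 → Finset (Fin 5))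
      (by decide) (by decide) with ⟨ω₀, ω, hdet⟩ | ⟨ω₀, ω, hdet⟩
  · exact hdet (additive_cex_direct_det_eq_zero ω₀ ω)
  · exact hdet (additive_cex_mirror_det_eq_zero ω₀ ω)

/-! ## 4. Doubly obstructed layouts at every scale -/

/-- **Doubly obstructed layouts.** Rows of size `≤ e` using few coordinates (`1 + |⋃ u| <` the number
of columns of weight `≤ 1`), columns containing an `(e+1)`-subcube `{Z ∪ S : S ⊆ T}`: the additive
matrix AND its mirror are singular for every table. Instance: rows = all subsets of size `≤ e` of
`h − 2` coordinates (`r = C(h−2, ≤ e)`, exponential in `h` for `e ≈ h/2`), columns any `r` distinct sets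
containing `∅`, the `h` singletons and `2^T` with `|T| = e + 1`; taking the columns to be the ball
`B([h], e′) ∪ (Z ⊔ 2^T)` makes both obstructions survive the removal of poly(h) rows and columns. -/
theorem additive_doublyObstructed {ι : Type*} [Fintype ι] [DecidableEq ι]
    (u w : ι → Finset (Fin h)) (e : ℕ) (he : ∀ i, (u i).card ≤ e)
    (hcount : 1 + (Finset.univ.biUnion u).card < (Finset.univ.filter fun j => (w j).card ≤ 1).card)
    (Z T : Finset (Fin h)) (hZT : Disjoint Z T) (hT : e < T.card)
    (φ : Finset (Fin h) → ι) (hφ : ∀ S ∈ T.powerset, w (φ S) = Z ∪ S)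
    (ω₀ : Fin h → ℂ) (ω : Fin h → Fin h → ℂ) (ω₀' : Fin h → ℂ) (ω' : Fin h → Fin h → ℂ) :
    (Matrix.of fun i j : ι => ∏ c ∈ w j, (ω₀ c + ∑ a ∈ u i, ω a c)).det = 0 ∧
    (Matrix.of fun i j : ι => ∏ a ∈ u j, (ω₀' a + ∑ c ∈ w i, ω' c a)).det = 0 := by
  classical
  refine ⟨additiveMatrix_det_eq_zero_of_weightOne u w ω₀ ω ∅ (fun _ => Finset.empty_subset _)
      (by simpa using hcount), ?_⟩
  exact additiveMatrix_det_eq_zero_of_subcube w u ω₀' ω' ∅ (fun _ => Finset.empty_subset _) e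
    (by simpa using he) Z T hZT hT φ hφ

end

end Summit.ValiantsHypothesis.ValiantsHypothesis.Theorems.BarrierLever.AdditiveDoor
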